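/-
Copyright (c) 2026. All rights reserved.
Released under Apache 2.0 license as described in the file LICENSE.
-/
import Literature.Probability.Percolation.DecisionTreeTying
import HarnessLib

/-!
# The convolution of increasing functions is increasing (Dubey–Sahi–Wang 2024, Theorem 11)

Topic `Literature/Probability/Percolation`.  CITATION HEADER.  Source: P. Dubey, S. Sahi, G. Wang, *Putting all
eggs in one basket: some insights from a correlation inequality*, arXiv:2403.15957v2 (27 Aug 2024)
[DubeySahiWang2024], §6 "Proofs" (pp. 10–12), read 2026-08-20 from the materialised arXiv text (corpus
`paper:arxiv-2403.15957`, p0010–p0012).  This is the two-function precursor of Dubey–Sahi's tying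
monotonicity [DubeySahi2025, Thm. D] (tree: `DecisionTree.Tying.thmD`, `DecisionTreeTying.lean`); it is one of
Sahi's own sequels to the `E_n` programme [Sahi2008] and is recorded here VERBATIM, with its printed proof.

THE PRINTED SETTING (p. 10, verbatim).  "Let `𝓗` be the set of subsets of a finite set `H`.  For `S` in `𝓗` we
define a probabilty measure `µ_S` on `𝓗 × 𝓗` as follows: `µ_S(S₁, S₂) = 0` if `S ∩ S₁ ≠ S ∩ S₂`, otherwise
`µ_S(S₁, S₂) = P(S, S₁) P(H ∖ S, S₁) P(H ∖ S, S₂)` where `P(X, Y) := ∏_{h ∈ X ∩ Y} (p_h) ∏_{h ∈ X ∖ Y} (1 − p_h)`.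
Then `µ_S(S₁, S₂)` is precisely the probability that the following random procedure leads to the pair
`(S₁, S₂)`: • For each `h` in `S` we toss a coin with probability `p_h` of landing heads; if heads we include `h`
in both `S₁` and `S₂`, and if tails then we exclude `h` from both sets. • For each `h` in `H ∖ S` we toss the coin
once to decide whether to include `h` in `S₁`, and once again, independently, to decide whether to include `h`
in `S₂`.  **Definition 10** If `f` and `g` are real valued functions on `𝓗` then we define
`f ⋆ g(S) := Σ_{S₁,S₂ ⊆ H} f(S₁) g(S₂) µ_S(S₁, S₂)` (3).  As before, we say that `f` is increasing if `S ⊇ T`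
implies `f(S) ≥ f(T)`."

**Theorem 11** (p. 10): "If `f` and `g` are increasing functions then so is `f ⋆ g`."
**Lemma 12** (p. 10): "Theorem 11 holds for the case `|H| = 1`."  Printed proof: with `H = {h}`, `p = p_h`,
`a = f(∅)`, `b = g(∅)`, `c = f ⋆ g(∅)`, `a′ = f(H)`, `b′ = g(H)`, `c′ = f ⋆ g(H)`:
"`c = [(1 − p)a + pa′][(1 − p)b + pb′]`, `c′ = (1 − p)ab + pa′b′`, `c′ − c = p(1 − p)(a′ − a)(b′ − b)`.  Since `f`
and `g` are increasing we have `a′ ≥ a`, `b′ ≥ b`, and thus `c′ − c ≥ 0`."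
Proof of Theorem 11 (p. 11): "It clearly suffices to show that `f ⋆ g(S) ≥ f ⋆ g(T)` in the case where `S ∖ T`
consists of a single element, `h`, say.  Then the two coin tossing procedures agree on `H′ = H ∖ {h}` and by
grouping terms we can rewrite `f ⋆ g(S) = Σ_{T₁,T₂ ⊆ H′} f_{T₁} ⋆ g_{T₂}({h}) µ′_T(T₁,T₂)` (4),
`f ⋆ g(T) = Σ_{T₁,T₂ ⊆ H′} f_{T₁} ⋆ g_{T₂}(∅) µ′_T(T₁,T₂)` (5) … By Lemma 12 each term in (4) dominates the
corresponding term in (5), and thus the result follows."  "For the two extreme cases `S = H` and `S = ∅` we have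
`f ⋆ g(H) = Exp(fg)`, `f ⋆ g(∅) = Exp(f) Exp(g)`, where `Exp` is the expectation with respect to the measure `µ`
on `𝓗` defined by `µ(S) = ∏_{h ∈ S} p_h ∏_{h ∉ S} (1 − p_h) = P(H, S)` (6).  Thus we obtain the following
well-known inequality due to Harris.  **Corollary 13** If `f` and `g` are increasing then we have
`Exp(fg) ≥ Exp(f) Exp(g)` (7)."  "If `F = {f_i, i ∈ I}` is an set of functions and `π : I₁ ⊔ ⋯ ⊔ I_k` is a
partition of the index set `I` then we define `E_F(π) = Exp(∏_{i ∈ I₁} f_i) ⋯ Exp(∏_{i ∈ I_k} f_i)`.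
**Corollary 14** Let `F` be a finite set of non-negative increasing functions and let `π` and `π′` be partitions
of `I` such that `π′` refines `π` then we have `E_F(π′) ≤ E_F(π)`.  Proof.  If `f₁, …, f_k` are nonnegative and
increasing, then so is their product.  Now the result follows by iterated application of (7)."
§6.3 (p. 12, proof of Prop. 4): "`F = (1 − f) ⋆ (1 − g) = (f − 1) ⋆ (g − 1)` … Since `(f − 1)` and `(g − 1)` are
increasing functions so is `F`."

## What is here (everything PROVED; no named facts; axioms `propext`, `Classical.choice`, `Quot.sound`)

Modelling (as in the sibling `DecisionTree*` files): the ground set `H` is a finite type `ι`, a subset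
`S₁ ⊆ H` is a configuration `S₁ : ι → Bool`, the tying set `S` is a `Finset ι`, `p : ι → ℝ` (the inequality
needs `0 ≤ p ≤ 1`).  The pair law `µ_S` is DEFINED by the printed coin-tossing description — coordinatewise
weights `muS p S h` on `Bool × Bool` (one shared `p_h`-coin at `h ∈ S`, two independent ones at `h ∉ S`),
`mu p S S₁ S₂ = ∏_h muS p S h (S₁ h, S₂ h)` — and the printed closed form with `P(X,Y)` is the theorem `mu_eq`.
* `P`, `pairWt`, `muS`, `mu`, `conv` (`f ⋆ g (S)`, display (3)); `mu_eq` (the printed formula for `µ_S`);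
  `conv_eq_ex` (`f ⋆ g(S)` is the expectation `DecisionTree.Ex (muS p S)` of `f(S₁)g(S₂)` over pair
  configurations — the bridge to Gladkov's resampling calculus used by `DecisionTreeTying.lean`).
* Lemma 12 as the printed computation: `sum_pairWt_false` (`c`), `sum_pairWt_true` (`c′`), `lemma12`
  (`c′ − c = p(1−p)(a′−a)(b′−b)`), `lemma12_le`.
* `resampleLE_muS` — displays (4)/(5) + Lemma 12: passing from `T` to `S ⊇ T` is, coordinate by coordinate,
  Gladkov's resampling condition (18) (`DecisionTree.ResampleLE`); **`thm11`** / `conv_mono` — THEOREM 11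
  (`S ↦ f ⋆ g(S)` is increasing for increasing `f, g`; NO sign condition on `f, g`, as printed), via
  `DecisionTree.ex_le_ex` (the one-coordinate-at-a-time telescoping = "it suffices that `S ∖ T` is a single
  element").
* `conv_univ` (`f ⋆ g(H) = Exp(fg)`), `conv_empty` (`f ⋆ g(∅) = Exp(f)Exp(g)`), `ex_bern_eq_sum_P` (display (6):
  `Exp` is the expectation under `µ(S) = P(H,S)`), **`cor13`** — COROLLARY 13, Harris' inequality for
  increasing `f, g` of either sign; `sum_mu_left` / `sum_mu_right` (both marginals of `µ_S` are `µ`, for every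
  `S`), `conv_const_left` / `conv_const_right` (`c ⋆ g ≡ c·Exp(g)`), `conv_neg_neg` (§6.3:
  `(1−f) ⋆ (1−g) = (f−1) ⋆ (g−1)`), `conv_one_sub_mono` (Prop. 4's `F` is increasing).
* **`cor14`** — COROLLARY 14 with partitions of the index type `κ` presented as colourings (`col : κ → γ`,
  blocks = fibres; `π′` refines `π` iff `col_π = r ∘ col_{π′}`), as in `DecisionTreeTying.lean`:
  `E_F(π) := ∏_c Exp(∏_{i : col i = c} f_i)` (`EF`) satisfies `E_F(π′) ≤ E_F(π)`; proof as printed (products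
  of nonnegative increasing functions are nonnegative increasing, `prod_nonneg_monotone`, + the `n`-function
  Harris inequality `DecisionTree.Tying.harris_prod` [DubeySahi2025, Thm. E] inside each block of `π`).

Not here: the economic Propositions 1–9 (each is Theorem 11 / Corollary 14 read on a payoff function).

## References
* P. Dubey, S. Sahi, G. Wang, arXiv:2403.15957v2 (2024), §6: Def. 10, Thm. 11, Lemma 12, Cors. 13–14,
  §6.3. [DubeySahiWang2024]
* P. Dubey, S. Sahi, arXiv:2503.01663v2 (2025), Thms. D, E (tree: `DecisionTreeTying.lean`). [DubeySahi2025]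
* T. E. Harris, Proc. Cambridge Philos. Soc. 56 (1960) 13–20 (Cor. 13). [Harris1960]
-/

noncomputable section

open Classical

namespace Literature.Probability.Percolation

namespace DubeySahiWang

open Finset Function DecisionTree DecisionTree.Richards

variable {ι : Type*} [Fintype ι] [DecidableEq ι]

/-! ### The pair law `µ_S` and the convolution `f ⋆ g` -/

omit [Fintype ι] [DecidableEq ι] in
/-- `P(X, Y) := ∏_{h ∈ X ∩ Y} p_h ∏_{h ∈ X ∖ Y} (1 − p_h)` for `X ⊆ H` and a configuration `Y`
(`bw q b = q` for `b = 1`, `1 − q` for `b = 0`). [cite: DubeySahiWang2024, §6 (p. 10)] -/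
def P (p : ι → ℝ) (X : Finset ι) (Y : ι → Bool) : ℝ := ∏ h ∈ X, bw (p h) (Y h)

/-- One coordinate of the coin-tossing procedure: at a TIED coordinate (`t = 1`, "`h` in `S`") one
`q`-coin decides both copies ("if heads we include `h` in both `S₁` and `S₂`, and if tails then we exclude `h`
from both"); at a FREE coordinate (`t = 0`, "`h` in `H ∖ S`") two independent `q`-coins.
[cite: DubeySahiWang2024, §6 (p. 10)] -/
def pairWt (q : ℝ) (t : Bool) (x : Bool × Bool) : ℝ :=
  if t then (if x.1 = x.2 then bw q x.1 else 0) else bw q x.1 * bw q x.2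

omit [Fintype ι] in
/-- The coordinatewise weights of `µ_S`: tied at `h ∈ S`, free at `h ∉ S`. [cite: DubeySahiWang2024, §6 (p. 10)] -/
def muS (p : ι → ℝ) (S : Finset ι) (h : ι) (x : Bool × Bool) : ℝ :=
  if h ∈ S then pairWt (p h) true x else pairWt (p h) false x

/-- The pair law `µ_S(S₁, S₂)` on `𝓗 × 𝓗` ("precisely the probability that the following random procedure
leads to the pair `(S₁, S₂)`"). [cite: DubeySahiWang2024, §6 (p. 10)] -/
def mu (p : ι → ℝ) (S : Finset ι) (S₁ S₂ : ι → Bool) : ℝ := ∏ h, muS p S h (S₁ h, S₂ h)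

/-- **Definition 10**: `f ⋆ g(S) := Σ_{S₁,S₂ ⊆ H} f(S₁) g(S₂) µ_S(S₁, S₂)` (3).
[cite: DubeySahiWang2024, Definition 10] -/
def conv (p : ι → ℝ) (f g : (ι → Bool) → ℝ) (S : Finset ι) : ℝ :=
  ∑ S₁ : ι → Bool, ∑ S₂ : ι → Bool, f S₁ * g S₂ * mu p S S₁ S₂

/-- Unfolding `pairWt` at a tied coordinate. [cite: DubeySahiWang2024, §6 (p. 10)] -/
theorem pairWt_true (q : ℝ) (x : Bool × Bool) :
    pairWt q true x = if x.1 = x.2 then bw q x.1 else 0 := rfl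

/-- Unfolding `pairWt` at a free coordinate. [cite: DubeySahiWang2024, §6 (p. 10)] -/
theorem pairWt_false (q : ℝ) (x : Bool × Bool) : pairWt q false x = bw q x.1 * bw q x.2 := rfl

/-- `pairWt q t ≥ 0` for `q ∈ [0,1]` ("a probabilty measure `µ_S`"). [cite: DubeySahiWang2024, §6 (p. 10)] -/
theorem pairWt_nonneg {q : ℝ} (hq0 : 0 ≤ q) (hq1 : q ≤ 1) (t : Bool) (x : Bool × Bool) : 0 ≤ pairWt q t x := by
  unfold pairWt
  split_ifs
  · exact bw_nonneg hq0 hq1 _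
  · exact le_rfl
  · exact mul_nonneg (bw_nonneg hq0 hq1 _) (bw_nonneg hq0 hq1 _)

omit [Fintype ι] in
/-- `muS p S ≥ 0` for `p ∈ [0,1]^H` ("a probabilty measure `µ_S`"). [cite: DubeySahiWang2024, §6 (p. 10)] -/
theorem muS_nonneg {p : ι → ℝ} (hp0 : ∀ i, 0 ≤ p i) (hp1 : ∀ i, p i ≤ 1) (S : Finset ι) (h : ι)
    (x : Bool × Bool) : 0 ≤ muS p S h x := by
  unfold muS
  split_ifs
  · exact pairWt_nonneg (hp0 h) (hp1 h) _ _
  · exact pairWt_nonneg (hp0 h) (hp1 h) _ _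

/-- The first marginal of one coordinate of `µ_S` is the `q`-coin, tied or free. [folklore] -/
private theorem sum_pairWt_fst (q : ℝ) (t b₂ : Bool) : ∑ b₁, pairWt q t (b₁, b₂) = bw q b₂ := by
  cases t <;> cases b₂ <;> simp [pairWt, bw] <;> ring

/-- The second marginal of one coordinate of `µ_S` is the `q`-coin, tied or free. [folklore] -/
private theorem sum_pairWt_snd (q : ℝ) (t b₁ : Bool) : ∑ b₂, pairWt q t (b₁, b₂) = bw q b₁ := by
  cases t <;> cases b₁ <;> simp [pairWt, bw] <;> ring

/-- **The printed formula for `µ_S`**: `µ_S(S₁, S₂) = 0` if `S ∩ S₁ ≠ S ∩ S₂`, otherwise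
`µ_S(S₁, S₂) = P(S, S₁) P(H ∖ S, S₁) P(H ∖ S, S₂)`. [cite: DubeySahiWang2024, §6 (p. 10)] -/
theorem mu_eq (p : ι → ℝ) (S : Finset ι) (S₁ S₂ : ι → Bool) :
    mu p S S₁ S₂ = if (∀ h ∈ S, S₁ h = S₂ h) then P p S S₁ * P p Sᶜ S₁ * P p Sᶜ S₂ else 0 := by
  unfold mu
  -- split the product over `S` and `Sᶜ`
  rw [← prod_mul_prod_compl S]
  have hS : ∏ h ∈ S, muS p S h (S₁ h, S₂ h) = ∏ h ∈ S, (if S₁ h = S₂ h then bw (p h) (S₁ h) else 0) :=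
    prod_congr rfl fun h hh => by rw [muS, if_pos hh, pairWt_true]
  have hSc : ∏ h ∈ Sᶜ, muS p S h (S₁ h, S₂ h) = ∏ h ∈ Sᶜ, (bw (p h) (S₁ h) * bw (p h) (S₂ h)) :=
    prod_congr rfl fun h hh => by rw [muS, if_neg (mem_compl.1 hh), pairWt_false]
  rw [hS, hSc, prod_mul_distrib]
  split_ifs with hagree
  · rw [prod_congr rfl fun h hh => if_pos (hagree h hh)]
    simp only [P]
    ring
  · push Not at hagree
    obtain ⟨h, hh, hne⟩ := hagree
    rw [prod_eq_zero hh (if_neg hne), zero_mul]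

/-- **Both marginals of `µ_S` are `µ`**, whatever `S`: `Σ_{S₁} µ_S(S₁, S₂) = P(H, S₂)`.
[cite: DubeySahiWang2024, §6 (p. 10: "toss the coin once … and once again, independently")] -/
theorem sum_mu_left (p : ι → ℝ) (S : Finset ι) (S₂ : ι → Bool) : ∑ S₁, mu p S S₁ S₂ = P p univ S₂ := by
  unfold mu P
  rw [← Fintype.prod_sum fun h b₁ => muS p S h (b₁, S₂ h)]
  refine prod_congr rfl fun h _ => ?_
  show ∑ b₁, muS p S h (b₁, S₂ h) = bw (p h) (S₂ h)
  unfold muS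
  split_ifs
  · exact sum_pairWt_fst _ _ _
  · exact sum_pairWt_fst _ _ _

/-- `Σ_{S₂} µ_S(S₁, S₂) = P(H, S₁)`. [cite: DubeySahiWang2024, §6 (p. 10)] -/
theorem sum_mu_right (p : ι → ℝ) (S : Finset ι) (S₁ : ι → Bool) : ∑ S₂, mu p S S₁ S₂ = P p univ S₁ := by
  unfold mu P
  rw [← Fintype.prod_sum fun h b₂ => muS p S h (S₁ h, b₂)]
  refine prod_congr rfl fun h _ => ?_
  show ∑ b₂, muS p S h (S₁ h, b₂) = bw (p h) (S₁ h)
  unfold muS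
  split_ifs
  · exact sum_pairWt_snd _ _ _
  · exact sum_pairWt_snd _ _ _

omit [Fintype ι] [DecidableEq ι] in
/-- A pair of configurations `(S₁, S₂)` read as one pair configuration `h ↦ (S₁ h, S₂ h)`. [folklore] -/
private def pairEquiv : ((ι → Bool) × (ι → Bool)) ≃ (ι → Bool × Bool) where
  toFun x h := (x.1 h, x.2 h)
  invFun C := (fun h => (C h).1, fun h => (C h).2)
  left_inv _ := rfl
  right_inv _ := rfl

/-- **`f ⋆ g(S)` as an expectation over pair configurations**: with a pair `(S₁, S₂)` read as one
configuration `C : H → {0,1}²`, `f ⋆ g(S) = Ex (muS p S) [f(C₁) g(C₂)]` in the coordinatewise-weights calculus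
of `DecisionTreeGenerating.lean`. [cite: DubeySahiWang2024, Definition 10] -/
theorem conv_eq_ex (p : ι → ℝ) (f g : (ι → Bool) → ℝ) (S : Finset ι) :
    conv p f g S = Ex (muS p S) (fun C => f (fun h => (C h).1) * g (fun h => (C h).2)) := by
  unfold conv Ex mu
  rw [← Fintype.sum_prod_type']
  exact Fintype.sum_equiv pairEquiv _ _ fun x => by simp only [pairEquiv, Equiv.coe_fn_mk]; ring

/-! ### Lemma 12: the case `|H| = 1` -/

/-- `c = [(1 − p)a + pa′][(1 − p)b + pb′]`: the free coordinate. [cite: DubeySahiWang2024, Lemma 12 (proof)] -/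
theorem sum_pairWt_false (q : ℝ) (φ ψ : Bool → ℝ) :
    ∑ x : Bool × Bool, pairWt q false x * (φ x.1 * ψ x.2) =
      ((1 - q) * φ false + q * φ true) * ((1 - q) * ψ false + q * ψ true) := by
  simp only [pairWt_false, Fintype.sum_prod_type, Fintype.sum_bool, bw, if_true, Bool.false_eq_true,
    if_false]
  ring

/-- `c′ = (1 − p)ab + pa′b′`: the tied coordinate. [cite: DubeySahiWang2024, Lemma 12 (proof)] -/
theorem sum_pairWt_true (q : ℝ) (φ ψ : Bool → ℝ) :
    ∑ x : Bool × Bool, pairWt q true x * (φ x.1 * ψ x.2) =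
      (1 - q) * (φ false * ψ false) + q * (φ true * ψ true) := by
  simp only [pairWt_true, Fintype.sum_prod_type, Fintype.sum_bool, bw, if_true, Bool.false_eq_true,
    if_false, Bool.true_eq_false]
  ring

/-- **Lemma 12** (the computation): `c′ − c = p(1 − p)(a′ − a)(b′ − b)`.
[cite: DubeySahiWang2024, Lemma 12] -/
theorem lemma12 (q : ℝ) (φ ψ : Bool → ℝ) :
    ∑ x : Bool × Bool, pairWt q true x * (φ x.1 * ψ x.2) -
        ∑ x : Bool × Bool, pairWt q false x * (φ x.1 * ψ x.2) =
      q * (1 - q) * (φ true - φ false) * (ψ true - ψ false) := by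
  rw [sum_pairWt_true, sum_pairWt_false]
  ring

/-- **Lemma 12** (the inequality): for `p ∈ [0,1]` and `a′ ≥ a`, `b′ ≥ b`, `c ≤ c′`.
[cite: DubeySahiWang2024, Lemma 12] -/
theorem lemma12_le {q : ℝ} (hq0 : 0 ≤ q) (hq1 : q ≤ 1) {φ ψ : Bool → ℝ} (hφ : φ false ≤ φ true)
    (hψ : ψ false ≤ ψ true) :
    ∑ x : Bool × Bool, pairWt q false x * (φ x.1 * ψ x.2) ≤
      ∑ x : Bool × Bool, pairWt q true x * (φ x.1 * ψ x.2) := by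
  rw [← sub_nonneg, lemma12]
  exact mul_nonneg (mul_nonneg (mul_nonneg hq0 (by linarith)) (by linarith)) (by linarith)

/-! ### Theorem 11 -/

omit [Fintype ι] in
/-- The first copy of an updated pair configuration. [folklore] -/
private theorem fst_update (C : ι → Bool × Bool) (e : ι) (x : Bool × Bool) :
    (fun h => (update C e x h).1) = update (fun h => (C h).1) e x.1 := by
  funext h
  by_cases hh : h = e
  · subst hh; simp
  · simp [hh]

omit [Fintype ι] in
/-- The second copy of an updated pair configuration. [folklore] -/
private theorem snd_update (C : ι → Bool × Bool) (e : ι) (x : Bool × Bool) :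
    (fun h => (update C e x h).2) = update (fun h => (C h).2) e x.2 := by
  funext h
  by_cases hh : h = e
  · subst hh; simp
  · simp [hh]

omit [Fintype ι] in
/-- An increasing function increases when one coordinate is raised. [folklore] -/
private theorem apply_update_false_le {f : (ι → Bool) → ℝ} (hf : Monotone f) (x : ι → Bool) (e : ι) :
    f (update x e false) ≤ f (update x e true) :=
  hf (update_le_update_iff.2 ⟨Bool.false_le _, fun _ _ => le_rfl⟩)

omit [Fintype ι] in
/-- **Displays (4)/(5) with Lemma 12, coordinate by coordinate**: for `T ⊆ S` and increasing `f, g`,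
resampling any one coordinate of a pair configuration from `µ_S` rather than from `µ_T` does not decrease
the conditional expectation of `f(S₁)g(S₂)` — Gladkov's condition (18) between the coordinatewise weights
`muS p T` and `muS p S`.  At `h ∈ S ∖ T` this is Lemma 12 for `f_{T₁}, g_{T₂}`; elsewhere the two procedures
agree. [cite: DubeySahiWang2024, Theorem 11 (proof, displays (4)–(5))] -/
theorem resampleLE_muS {p : ι → ℝ} (hp0 : ∀ i, 0 ≤ p i) (hp1 : ∀ i, p i ≤ 1) {S T : Finset ι}
    (hTS : T ⊆ S) {f g : (ι → Bool) → ℝ} (hf : Monotone f) (hg : Monotone g) :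
    ResampleLE (muS p T) (muS p S) (fun C => f (fun h => (C h).1) * g (fun h => (C h).2)) := by
  intro C e
  -- the integrand after resampling coordinate `e` to `x`: `f_{T₁}(x₁) g_{T₂}(x₂)`
  have h1 : ∀ x : Bool × Bool,
      (fun C : ι → Bool × Bool => f (fun h => (C h).1) * g (fun h => (C h).2)) (update C e x) =
        f (update (fun h => (C h).1) e x.1) * g (update (fun h => (C h).2) e x.2) := fun x => by
    show f (fun h => (update C e x h).1) * g (fun h => (update C e x h).2) = _
    rw [fst_update, snd_update]
  have hL : ∀ U : Finset ι,
      ∑ x, muS p U e x * (fun C : ι → Bool × Bool => f (fun h => (C h).1) * g (fun h => (C h).2))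
        (update C e x) =
      ∑ x, muS p U e x * (f (update (fun h => (C h).1) e x.1) * g (update (fun h => (C h).2) e x.2)) :=
    fun U => sum_congr rfl fun x _ => by rw [h1 x]
  rw [hL T, hL S]
  by_cases heT : e ∈ T
  · -- tied in both procedures
    have hT : muS p T e = pairWt (p e) true := funext fun x => by rw [muS, if_pos heT]
    have hS : muS p S e = pairWt (p e) true := funext fun x => by rw [muS, if_pos (hTS heT)]
    rw [hT, hS]
  · by_cases heS : e ∈ S
    · -- free under `T`, tied under `S`: Lemma 12
      have hT : muS p T e = pairWt (p e) false := funext fun x => by rw [muS, if_neg heT]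
      have hS : muS p S e = pairWt (p e) true := funext fun x => by rw [muS, if_pos heS]
      rw [hT, hS]
      exact lemma12_le (hp0 e) (hp1 e) (φ := fun b => f (update (fun h => (C h).1) e b))
        (ψ := fun b => g (update (fun h => (C h).2) e b)) (apply_update_false_le hf _ e)
        (apply_update_false_le hg _ e)
    · -- free in both procedures
      have hT : muS p T e = pairWt (p e) false := funext fun x => by rw [muS, if_neg heT]
      have hS : muS p S e = pairWt (p e) false := funext fun x => by rw [muS, if_neg heS]
      rw [hT, hS]

/-- **Theorem 11 (Dubey–Sahi–Wang 2024).**  If `f` and `g` are increasing functions on `𝓗` then so is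
`S ↦ f ⋆ g(S)` (for coin probabilities `p ∈ [0,1]^H`; no sign condition on `f, g`).
[cite: DubeySahiWang2024, Theorem 11] -/
theorem conv_mono {p : ι → ℝ} (hp0 : ∀ i, 0 ≤ p i) (hp1 : ∀ i, p i ≤ 1) {f g : (ι → Bool) → ℝ}
    (hf : Monotone f) (hg : Monotone g) {S T : Finset ι} (hTS : T ⊆ S) : conv p f g T ≤ conv p f g S := by
  rw [conv_eq_ex, conv_eq_ex]
  exact ex_le_ex (resampleLE_muS hp0 hp1 hTS hf hg) (fun h x => muS_nonneg hp0 hp1 T h x)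
    fun h x => muS_nonneg hp0 hp1 S h x

/-- **Theorem 11**, stated as monotonicity of `f ⋆ g : 𝓗 → ℝ`. [cite: DubeySahiWang2024, Theorem 11] -/
theorem thm11 {p : ι → ℝ} (hp0 : ∀ i, 0 ≤ p i) (hp1 : ∀ i, p i ≤ 1) {f g : (ι → Bool) → ℝ}
    (hf : Monotone f) (hg : Monotone g) : Monotone (conv p f g) :=
  fun _ _ hTS => conv_mono hp0 hp1 hf hg hTS

/-! ### The two extreme cases and Corollary 13 (Harris) -/

/-- Display (6): `Exp` is the expectation under `µ(S) = ∏_{h ∈ S} p_h ∏_{h ∉ S} (1 − p_h) = P(H, S)`; in the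
tree this is `DecisionTree.Ex (bern p)`. [cite: DubeySahiWang2024, §6 display (6)] -/
theorem ex_bern_eq_sum_P (p : ι → ℝ) (f : (ι → Bool) → ℝ) : Ex (bern p) f = ∑ S, P p univ S * f S := rfl

/-- At `S = H` the pair law is the push-forward of `µ` along the diagonal `S ↦ (S, S)`. [folklore] -/
private theorem muS_univ (p : ι → ℝ) :
    muS p univ = pushWeights (fun (_ : ι) (b : Bool) => (b, b)) (bern p) := by
  funext h x
  rcases x with ⟨b₁, b₂⟩
  rw [muS, if_pos (mem_univ h), pairWt_true, pushWeights]
  cases b₁ <;> cases b₂ <;> simp [bern]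

/-- **`f ⋆ g(H) = Exp(fg)`.** [cite: DubeySahiWang2024, §6 (p. 11)] -/
theorem conv_univ (p : ι → ℝ) (f g : (ι → Bool) → ℝ) :
    conv p f g univ = Ex (bern p) (fun S => f S * g S) := by
  rw [conv_eq_ex, muS_univ, ex_pushWeights]

/-- **`f ⋆ g(∅) = Exp(f) Exp(g)`.** [cite: DubeySahiWang2024, §6 (p. 11)] -/
theorem conv_empty (p : ι → ℝ) (f g : (ι → Bool) → ℝ) :
    conv p f g ∅ = Ex (bern p) f * Ex (bern p) g := by
  have hmu : ∀ S₁ S₂ : ι → Bool, mu p ∅ S₁ S₂ = P p univ S₁ * P p univ S₂ := fun S₁ S₂ => by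
    unfold mu P
    rw [← prod_mul_distrib]
    exact prod_congr rfl fun h _ => by rw [muS, if_neg (notMem_empty h), pairWt_false]
  simp_rw [conv, hmu, ex_bern_eq_sum_P, sum_mul_sum]
  exact sum_congr rfl fun S₁ _ => sum_congr rfl fun S₂ _ => by ring

/-- **Corollary 13 (Harris' inequality).**  If `f` and `g` are increasing then `Exp(fg) ≥ Exp(f) Exp(g)` —
from Theorem 11 at `∅ ⊆ H` (no sign condition on `f, g`). [cite: DubeySahiWang2024, Corollary 13]
[cite: Harris1960, Lemma 4.1] -/
theorem cor13 {p : ι → ℝ} (hp0 : ∀ i, 0 ≤ p i) (hp1 : ∀ i, p i ≤ 1) {f g : (ι → Bool) → ℝ}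
    (hf : Monotone f) (hg : Monotone g) : Ex (bern p) f * Ex (bern p) g ≤ Ex (bern p) (fun S => f S * g S) := by
  rw [← conv_empty, ← conv_univ]
  exact conv_mono hp0 hp1 hf hg (empty_subset _)

/-! ### Bilinearity remarks used in §6.3 -/

/-- A constant first factor: `c ⋆ g(S) = c · Exp(g)` for EVERY `S` (the second marginal of `µ_S` is `µ`).
[cite: DubeySahiWang2024, §6 (p. 10)] -/
theorem conv_const_left (p : ι → ℝ) (c : ℝ) (g : (ι → Bool) → ℝ) (S : Finset ι) :
    conv p (fun _ => c) g S = c * Ex (bern p) g := by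
  unfold conv
  rw [sum_comm, ex_bern_eq_sum_P, mul_sum]
  refine sum_congr rfl fun S₂ _ => ?_
  have h : ∑ S₁, c * g S₂ * mu p S S₁ S₂ = c * g S₂ * ∑ S₁, mu p S S₁ S₂ := by rw [mul_sum]
  rw [h, sum_mu_left]
  ring

/-- A constant second factor: `f ⋆ c(S) = c · Exp(f)` for every `S`. [cite: DubeySahiWang2024, §6 (p. 10)] -/
theorem conv_const_right (p : ι → ℝ) (f : (ι → Bool) → ℝ) (c : ℝ) (S : Finset ι) :
    conv p f (fun _ => c) S = c * Ex (bern p) f := by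
  unfold conv
  rw [ex_bern_eq_sum_P, mul_sum]
  refine sum_congr rfl fun S₁ _ => ?_
  have h : ∑ S₂, f S₁ * c * mu p S S₁ S₂ = f S₁ * c * ∑ S₂, mu p S S₁ S₂ := by rw [mul_sum]
  rw [h, sum_mu_right]
  ring

/-- `(−f) ⋆ (−g) = f ⋆ g`, whence §6.3's `(1 − f) ⋆ (1 − g) = (f − 1) ⋆ (g − 1)`.
[cite: DubeySahiWang2024, §6.3] -/
theorem conv_neg_neg (p : ι → ℝ) (f g : (ι → Bool) → ℝ) (S : Finset ι) :
    conv p (fun x => -f x) (fun x => -g x) S = conv p f g S := by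
  unfold conv
  exact sum_congr rfl fun S₁ _ => sum_congr rfl fun S₂ _ => by ring

/-- **§6.3 (proof of Proposition 4)**: for increasing `f, g`, `F = (1 − f) ⋆ (1 − g) = (f − 1) ⋆ (g − 1)` is
increasing in `S`. [cite: DubeySahiWang2024, §6.3] -/
theorem conv_one_sub_mono {p : ι → ℝ} (hp0 : ∀ i, 0 ≤ p i) (hp1 : ∀ i, p i ≤ 1) {f g : (ι → Bool) → ℝ}
    (hf : Monotone f) (hg : Monotone g) : Monotone (conv p (fun x => 1 - f x) (fun x => 1 - g x)) := by
  have h : conv p (fun x => 1 - f x) (fun x => 1 - g x) = conv p (fun x => f x - 1) (fun x => g x - 1) := by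
    funext S
    unfold conv
    exact sum_congr rfl fun S₁ _ => sum_congr rfl fun S₂ _ => by ring
  rw [h]
  exact thm11 hp0 hp1 (fun x y hxy => sub_le_sub_right (hf hxy) 1) (fun x y hxy => sub_le_sub_right (hg hxy) 1)

/-! ### Corollary 14: coarser partitions of a family of nonnegative increasing functions -/

section Cor14

variable {κ : Type*} [Fintype κ] {γ : Type*} [Fintype γ] [DecidableEq γ] {γ' : Type*} [Fintype γ']
  [DecidableEq γ']

/-- `E_F(π) := Exp(∏_{i ∈ I₁} f_i) ⋯ Exp(∏_{i ∈ I_k} f_i)` for the partition `π` of the index type `κ` presented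
as a colouring `col : κ → γ` (blocks `I_c = {i : col i = c}`; an empty block contributes `Exp(1) = 1`).
[cite: DubeySahiWang2024, §6 (definition of E_F(π), p. 11)] -/
def EF (p : ι → ℝ) (f : κ → (ι → Bool) → ℝ) (col : κ → γ) : ℝ :=
  ∏ c, Ex (bern p) (fun S => ∏ i ∈ univ.filter (fun i => col i = c), f i S)

/-- `Ex (bern p)` of a nonnegative function is nonnegative (`p ∈ [0,1]^H`). [folklore] -/
private theorem ex_bern_nonneg {p : ι → ℝ} (hp0 : ∀ i, 0 ≤ p i) (hp1 : ∀ i, p i ≤ 1)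
    {F : (ι → Bool) → ℝ} (hF : ∀ S, 0 ≤ F S) : 0 ≤ Ex (bern p) F :=
  sum_nonneg fun S _ => mul_nonneg (prod_nonneg fun i _ => bern_nonneg hp0 hp1 i (S i)) (hF S)

omit [Fintype ι] [DecidableEq ι] [Fintype κ] in
/-- "If `f₁, …, f_k` are nonnegative and increasing, then so is their product."
[cite: DubeySahiWang2024, Corollary 14 (proof)] -/
theorem prod_nonneg_monotone (s : Finset κ) {f : κ → (ι → Bool) → ℝ} (hf0 : ∀ i S, 0 ≤ f i S)
    (hfm : ∀ i, Monotone (f i)) :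
    (∀ S, 0 ≤ ∏ i ∈ s, f i S) ∧ Monotone (fun S => ∏ i ∈ s, f i S) :=
  ⟨fun S => prod_nonneg fun i _ => hf0 i S,
    fun _ _ hST => prod_le_prod (fun i _ => hf0 i _) fun i _ => hfm i hST⟩

/-- **Corollary 14 (Dubey–Sahi–Wang 2024).**  For a finite family `F = (f_i)_{i ∈ κ}` of nonnegative increasing
functions and partitions `π′` (colouring `col`) refining `π` (colouring `r ∘ col`): `E_F(π′) ≤ E_F(π)`.  Proof as
printed: within each block of `π`, the blocks of `π′` it contains carry nonnegative increasing products, and the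
iterated Harris inequality (7) (`DecisionTree.Tying.harris_prod`) merges them.
[cite: DubeySahiWang2024, Corollary 14] [cite: DubeySahi2025, Theorem E] -/
theorem cor14 {p : ι → ℝ} (hp0 : ∀ i, 0 ≤ p i) (hp1 : ∀ i, p i ≤ 1) {f : κ → (ι → Bool) → ℝ}
    (hf0 : ∀ i S, 0 ≤ f i S) (hfm : ∀ i, Monotone (f i)) (col : κ → γ') (r : γ' → γ) :
    EF p f col ≤ EF p f (r ∘ col) := by
  -- inside the coarse block `c`, the product of the fine block products is the coarse block product
  have hblock : ∀ (c : γ) (S : ι → Bool),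
      ∏ c' : {c' // r c' = c}, ∏ i ∈ univ.filter (fun i => col i = c'.1), f i S =
        ∏ i ∈ univ.filter (fun i => (r ∘ col) i = c), f i S := by
    intro c S
    rw [← Finset.prod_subtype (univ.filter fun c' => r c' = c) (fun c' => by simp)
      (fun c' => ∏ i ∈ univ.filter (fun i => col i = c'), f i S)]
    rw [← Finset.prod_fiberwise_of_maps_to (s := univ.filter fun i => (r ∘ col) i = c)
      (t := univ.filter fun c' => r c' = c) (g := col)
      (fun i hi => by simpa only [mem_filter, mem_univ, true_and, Function.comp_apply] using hi)
      (fun i => f i S)]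
    refine prod_congr rfl fun c' hc' => ?_
    have hc : r c' = c := by simpa only [mem_filter, mem_univ, true_and] using hc'
    refine prod_congr ?_ fun _ _ => rfl
    ext i
    simp only [mem_filter, mem_univ, true_and, Function.comp_apply]
    exact ⟨fun h => ⟨by rw [h, hc], h⟩, fun h => h.2⟩
  unfold EF
  -- regroup the fine blocks `c'` by the coarse block `r c'` they lie in
  rw [← Fintype.prod_fiberwise r
    (fun c' => Ex (bern p) (fun S => ∏ i ∈ univ.filter (fun i => col i = c'), f i S))]
  refine prod_le_prod (fun c _ => prod_nonneg fun c' _ =>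
    ex_bern_nonneg hp0 hp1 (prod_nonneg_monotone _ hf0 hfm).1) fun c _ => ?_
  -- inside the coarse block `c`: the `n`-function Harris inequality for the fine block products
  have hH := Tying.harris_prod p hp0 hp1
    (f := fun (c' : {c' // r c' = c}) S => ∏ i ∈ univ.filter (fun i => col i = c'.1), f i S)
    (fun c' S => (prod_nonneg_monotone _ hf0 hfm).1 S)
    (fun e => Or.inl fun c' x => (prod_nonneg_monotone _ hf0 hfm).2
      (update_le_update_iff.2 ⟨Bool.false_le _, fun _ _ => le_rfl⟩))
  refine hH.trans (le_of_eq ?_)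
  congr 1
  funext S
  exact hblock c S

end Cor14

end DubeySahiWang

end Literature.Probability.Percolation

end
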